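/-
Copyright (c) 2026 the pub-hodgecm-mathlib formalisation cell (harness21).  Prover seat hodgecm-mathlib-K2E5-p16 (g4): Track B «K2-LIT»,
hLiu418 = stmt-HodgeConjecture-24832, ROAD Φ organ Φ6b-3⁺ (dealer K2E5-plan (g5) 06:21:58Z: «the ξ–η identity IS the continuation mechanism
(η continues, Γ₂⁻¹ entire)»): HOLOMORPHY OF `η(g, h; ·, β)` IN `α` FOR `h > 0` and the ENTIRE CONTINUATION of `ξ(g, h; ·, β)`; 2026-09-04.
-/
import Summits.HodgeConjecture.HodgeConjecture.Theorems.K2LiuHermTwoXiEtaIdentity              -- ★ p858047 (this seat): the identity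
import Summits.HodgeConjecture.HodgeConjecture.Theorems.K2LiuHermTwoEtaConvergence             -- ★ p857940 (this seat): convergence of `η`
import Summits.HodgeConjecture.HodgeConjecture.Theorems.K2LiuHermTwoConfluentXiHolomorphy     -- ★ p857877 (this seat): `abs_log_le_of_le`
import Mathlib.Analysis.SpecialFunctions.Gamma.Beta
import HarnessLib

/-!
# Crux `HLiu418`, ROAD Φ, organ Φ6b-3⁺: `η(g, h; ·, β)` is ENTIRE in `α` (`g, h > 0`) and `ξ(g, h; ·, β)` CONTINUES TO `ℂ`
# [Shimura1982, Thm 3.1, the `h > 0` half, Case II, m = κ = 2]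

Cell `hodgecm-mathlib`, crux item hLiu418 = `stmt-HodgeConjecture-24832`, route of record `HCCMUnconditional`; squad K2, LEAD F0P6-plan (g12), co-dealer
K2E5-plan (g5), prover K2E5-p16 (g4).  THEOREMS ONLY; lane `--supports stmt-HodgeConjecture-24832 --as helper`.

WHAT.  (1) `hasDerivAt_etaTwo_alpha` ∕ `differentiable_etaTwo_alpha`: for `g, h > 0` and `re β > 1` the function `α ↦ η(g, h; α, β)` is
complex-differentiable on all of `ℂ`, with derivative `∫ log det(x + h) · (η-integrand) dx` (differentiation under the integral sign; the
majorant on the ball `|α − α₀| < 1` is `|log det(2h)|·(|η-int(α₀ ± 1)|) + |η-int(α₀ + 2)| + |η-int(α₀)|`, integrable by ★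
`integrableOn_etaTwoIntegrand_of_posDef` — here `h > 0` is used through `det(x + h) ≥ det(2h) > 0` on `{x − h > 0}`).
(2) `differentiable_hermTwoGamma_inv`: `Γ₂(α)⁻¹ = π⁻¹ Γ(α)⁻¹ Γ(α − 1)⁻¹` is entire (★ Mathlib `Complex.differentiable_one_div_Gamma`).
(3) `differentiable_xiEtaRhs` + `xiTwo_eq_entire`: **the right-hand side `A(α) = 4π⁴ e^{iπ(β−α)} Γ₂(α)⁻¹ Γ₂(β)⁻¹ η(2g, πh; α, β)` of the ξ–η
identity is ENTIRE in `α`, and `ξ(g, h; α, β) = A(α)` on `re α > 3`** — Shimura's analytic continuation of `ξ(g, h; ·, β)` (`g, h > 0`,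
`re β > 1`) from its half-plane of absolute convergence to `ℂ`, as a theorem about ★ `xiTwo`.
NOT here: continuation in `β` below `re β = 1` and the singular `h` (both need [Shimura1982, §4]); the functional equation.
HONEST LABEL.  Count-neutral helper of the K2_Liu road; it pays no socket by itself: `HC_CM` is proved only modulo the 7 printed citations
(2 remaining named inputs: hLiu418 = `stmt-HodgeConjecture-24832`, h413 = `stmt-HodgeConjecture-24833`) until rung 0 closes.
-/

set_option autoImplicit false
-- the mandated namespace repeats the single-problem summit's segment (`HodgeConjecture.HodgeConjecture`)
set_option linter.dupNamespace false

noncomputable section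

open Complex MeasureTheory Set
open scoped ComplexOrder ComplexConjugate

namespace Summit.HodgeConjecture.HodgeConjecture.Cruxes.HLiu418.K2LiuHermTwoEtaHolomorphy

open Summit.HodgeConjecture.HodgeConjecture.Cruxes.HLiu418.K2LiuHermTwoGammaDefs
open Summit.HodgeConjecture.HodgeConjecture.Cruxes.HLiu418.K2LiuHermTwoConfluentXiDefs
open Summit.HodgeConjecture.HodgeConjecture.Cruxes.HLiu418.K2LiuHermTwoConfluentXiHolomorphy
open Summit.HodgeConjecture.HodgeConjecture.Cruxes.HLiu418.K2LiuHermTwoEtaDefs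
open Summit.HodgeConjecture.HodgeConjecture.Cruxes.HLiu418.K2LiuHermTwoEtaConvergence
open Summit.HodgeConjecture.HodgeConjecture.Cruxes.HLiu418.K2LiuHermTwoXiEtaIdentity

/-! ## Pointwise facts on the domain `{x − h > 0}` -/

/-- On the domain of `η(·, h; ·)` with `h = hermTwo e > 0`: `det(x + h) ≥ det(2h)` (chart form). -/
theorem det_two_le_det_add {e c : ℝ × ℂ × ℝ} (he : (hermTwo e).PosDef) (hc : (hermTwo c - hermTwo e).PosDef) :
    (e + e).1 * (e + e).2.2 - normSq (e + e).2.1 ≤ (c + e).1 * (c + e).2.2 - normSq (c + e).2.1 := by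
  have hu := (posDef_hermTwo_iff (c - e)).mp (by rwa [hermTwo_sub])
  have h2e := (posDef_hermTwo_iff (e + e)).mp (by rw [hermTwo_add]; exact he.add he)
  have h := det_add_ge (w := (e + e).2.1) (q := (e + e).2.2) hu.1 hu.2 h2e.1 h2e.2
  have hrw : ((c - e).1 + (e + e).1) * ((c - e).2.2 + (e + e).2.2) - normSq ((c - e).2.1 + (e + e).2.1) =
      (c + e).1 * (c + e).2.2 - normSq (c + e).2.1 := by
    simp only [Prod.fst_sub, Prod.snd_sub, Prod.fst_add, Prod.snd_add]
    rw [show c.2.1 - e.2.1 + (e.2.1 + e.2.1) = c.2.1 + e.2.1 by ring]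
    ring
  rw [hrw] at h
  exact h

/-- The norm of the `η`-integrand when `det(x + h) = p > 0` and `det(x − h) = q > 0` are real. -/
theorem norm_etaTwoIntegrand_eq {g h : Matrix (Fin 2) (Fin 2) ℂ} {c : ℝ × ℂ × ℝ} {p q : ℝ} (hp : 0 < p) (hq : 0 < q)
    (hp' : (hermTwo c + h).det = p) (hq' : (hermTwo c - h).det = q) (γ β : ℂ) :
    ‖etaTwoIntegrand g h γ β c‖ = ‖cexp (-(hermTwo c * g).trace)‖ * (p ^ (γ.re - 2) * q ^ (β.re - 2)) := by
  rw [etaTwoIntegrand_apply, hp', hq', norm_mul, norm_mul, norm_cpow_eq_rpow_re_of_pos hp, norm_cpow_eq_rpow_re_of_pos hq]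
  simp

/-- The `α`-derivative of the `η`-integrand: `log det(x + h) ·` integrand (`det(x + h) ≠ 0`). -/
theorem hasDerivAt_etaTwoIntegrand_alpha (g h : Matrix (Fin 2) (Fin 2) ℂ) (β : ℂ) {c : ℝ × ℂ × ℝ} (hc : (hermTwo c + h).det ≠ 0)
    (α : ℂ) : HasDerivAt (fun α : ℂ => etaTwoIntegrand g h α β c)
      (etaTwoIntegrand g h α β c * Complex.log ((hermTwo c + h).det)) α := by
  have hfun : (fun α : ℂ => etaTwoIntegrand g h α β c) =
      fun α => cexp (-(hermTwo c * g).trace) * ((hermTwo c + h).det ^ (α - 2) * (hermTwo c - h).det ^ (β - 2)) :=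
    funext fun α => etaTwoIntegrand_apply g h α β c
  rw [hfun, etaTwoIntegrand_apply]
  have hsub : HasDerivAt (fun α : ℂ => α - 2) 1 α := (hasDerivAt_id α).sub_const 2
  have hpow : HasDerivAt (fun y : ℂ => (hermTwo c + h).det ^ y) ((hermTwo c + h).det ^ (α - 2) * Complex.log ((hermTwo c + h).det))
      (α - 2) := (Complex.hasStrictDerivAt_const_cpow (Or.inl hc)).hasDerivAt
  have h1 := hpow.comp α hsub
  have h2 := (h1.mul_const ((hermTwo c - h).det ^ (β - 2))).const_mul (cexp (-(hermTwo c * g).trace))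
  exact h2.congr_deriv (by ring)

/-! ## `η(g, h; ·, β)` is entire in `α` -/

/-- **DIFFERENTIATION UNDER THE INTEGRAL SIGN FOR `η`**: for `g, h > 0`, `re β > 1` and every `α₀ ∈ ℂ`,
`α ↦ η(g, h; α, β)` has the complex derivative `∫_{x − h > 0} log det(x + h) · (η-integrand)(α₀) dx` at `α₀`. -/
theorem hasDerivAt_etaTwo_alpha {g h : Matrix (Fin 2) (Fin 2) ℂ} (hg : g.PosDef) (hh : h.PosDef) {β : ℂ} (hβ : 1 < β.re) (α₀ : ℂ) :
    HasDerivAt (fun α : ℂ => etaTwo g h α β)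
      (∫ c in etaTwoSet h, etaTwoIntegrand g h α₀ β c * Complex.log ((hermTwo c + h).det)) α₀ := by
  have hfun : (fun α : ℂ => etaTwo g h α β) = fun α => ∫ c in etaTwoSet h, etaTwoIntegrand g h α β c :=
    funext fun α => etaTwo_def g h α β
  rw [hfun]
  -- coordinates of `h` and the constant `δ = det(2h)`
  obtain ⟨e, rfl⟩ : ∃ e : ℝ × ℂ × ℝ, hermTwo e = h := ⟨_, hermTwo_eq_of_isHermitian hh.1⟩
  have h2e := (posDef_hermTwo_iff (e + e)).mp (by rw [hermTwo_add]; exact hh.add hh)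
  set δ : ℝ := (e + e).1 * (e + e).2.2 - normSq (e + e).2.1 with hδdef
  have hδ : 0 < δ := by rw [hδdef]; linarith [h2e.2]
  -- the four integrable majorant pieces
  have hI1 := (integrableOn_etaTwoIntegrand_of_posDef hg hh ((α₀.re + 1 : ℝ) : ℂ) hβ).norm
  have hI2 := (integrableOn_etaTwoIntegrand_of_posDef hg hh ((α₀.re - 1 : ℝ) : ℂ) hβ).norm
  have hI3 := (integrableOn_etaTwoIntegrand_of_posDef hg hh ((α₀.re + 2 : ℝ) : ℂ) hβ).norm
  have hI4 := (integrableOn_etaTwoIntegrand_of_posDef hg hh ((α₀.re : ℝ) : ℂ) hβ).norm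
  refine (hasDerivAt_integral_of_dominated_loc_of_deriv_le (μ := (volume : Measure (ℝ × ℂ × ℝ)).restrict (etaTwoSet (hermTwo e)))
    (F := fun α c => etaTwoIntegrand g (hermTwo e) α β c)
    (F' := fun α c => etaTwoIntegrand g (hermTwo e) α β c * Complex.log ((hermTwo c + hermTwo e).det))
    (bound := fun c => |Real.log δ| * (‖etaTwoIntegrand g (hermTwo e) ((α₀.re + 1 : ℝ) : ℂ) β c‖ +
        ‖etaTwoIntegrand g (hermTwo e) ((α₀.re - 1 : ℝ) : ℂ) β c‖) +
      (‖etaTwoIntegrand g (hermTwo e) ((α₀.re + 2 : ℝ) : ℂ) β c‖ + ‖etaTwoIntegrand g (hermTwo e) ((α₀.re : ℝ) : ℂ) β c‖))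
    (Metric.ball_mem_nhds α₀ zero_lt_one) ?_ ?_ ?_ ?_ ?_ ?_).2
  · -- measurability of `F α`
    exact Filter.Eventually.of_forall fun α => aestronglyMeasurable_etaTwoIntegrand g (hermTwo e) α β _
  · -- integrability at `α₀`
    exact integrableOn_etaTwoIntegrand_of_posDef hg hh α₀ hβ
  · -- measurability of `F' α₀`
    exact ((measurable_etaTwoIntegrand g (hermTwo e) α₀ β).mul
      (Complex.measurable_log.comp (continuous_det_hermTwo_add (hermTwo e)).measurable)).aestronglyMeasurable
  · -- THE DOMINATION on the ball `|α − α₀| < 1`, for `x` in the domain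
    refine (ae_restrict_iff' (measurableSet_etaTwoSet hh.1)).mpr (Filter.Eventually.of_forall fun c hc α hα => ?_)
    have hα' : ‖α - α₀‖ < 1 := by rw [← dist_eq_norm]; exact hα
    have hre : |α.re - α₀.re| < 1 := lt_of_le_of_lt (by rw [← Complex.sub_re]; exact Complex.abs_re_le_norm _) hα'
    obtain ⟨hcp, hcm⟩ := (mem_etaTwoSet_iff (hermTwo e) c).mp hc
    have hu := (posDef_hermTwo_iff (c - e)).mp (by rwa [hermTwo_sub])
    -- the two positive determinants
    set p : ℝ := (c + e).1 * (c + e).2.2 - normSq (c + e).2.1 with hpdef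
    set q : ℝ := (c - e).1 * (c - e).2.2 - normSq (c - e).2.1 with hqdef
    have hδp : δ ≤ p := det_two_le_det_add hh hcm
    have hp : 0 < p := lt_of_lt_of_le hδ hδp
    have hq : 0 < q := by rw [hqdef]; linarith [hu.2]
    have hp' : (hermTwo c + hermTwo e).det = p := by rw [← hermTwo_add, det_hermTwo]
    have hq' : (hermTwo c - hermTwo e).det = q := by rw [← hermTwo_sub, det_hermTwo]
    -- the logarithm and the power on the ball
    have hlog : ‖Complex.log ((hermTwo c + hermTwo e).det)‖ ≤ |Real.log δ| + p := by
      rw [hp', ← Complex.ofReal_log hp.le, Complex.norm_real, Real.norm_eq_abs]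
      have := abs_log_le_of_le hδ hδp one_pos
      rw [Real.rpow_one, div_one] at this
      exact this
    have hpow : p ^ (α.re - 2) ≤ p ^ (α₀.re + 1 - 2) + p ^ (α₀.re - 1 - 2) := by
      have h := Literature.Dynamics.TransferOperators.rpow_neg_le_add (a := 2 - α.re) (a₁ := 1 - α₀.re) (a₂ := 3 - α₀.re) hp
        (by linarith [(abs_lt.mp hre).2]) (by linarith [(abs_lt.mp hre).1])
      rw [neg_sub, neg_sub, neg_sub] at h
      rw [show α₀.re + 1 - 2 = α₀.re - 1 by ring, show α₀.re - 1 - 2 = α₀.re - 3 by ring]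
      exact h
    -- all norms in terms of `p`, `q`, `P = |e^{−τ(xg)}|`
    rw [norm_mul, norm_etaTwoIntegrand_eq hp hq hp' hq', norm_etaTwoIntegrand_eq hp hq hp' hq', norm_etaTwoIntegrand_eq hp hq hp' hq',
      norm_etaTwoIntegrand_eq hp hq hp' hq', norm_etaTwoIntegrand_eq hp hq hp' hq']
    simp only [Complex.ofReal_re]
    set P : ℝ := ‖cexp (-(hermTwo c * g).trace)‖ with hPdef
    have hP : 0 ≤ P := norm_nonneg _
    have hQ : 0 ≤ q ^ (β.re - 2) := Real.rpow_nonneg hq.le _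
    have hL : 0 ≤ ‖Complex.log ((hermTwo c + hermTwo e).det)‖ := norm_nonneg _
    have h1 : P * (p ^ (α.re - 2) * q ^ (β.re - 2)) * ‖Complex.log ((hermTwo c + hermTwo e).det)‖ ≤
        P * ((p ^ (α₀.re + 1 - 2) + p ^ (α₀.re - 1 - 2)) * q ^ (β.re - 2)) * (|Real.log δ| + p) := by
      gcongr
    have e1 : p ^ (α₀.re + 2 - 2) = p ^ (α₀.re + 1 - 2) * p := by
      rw [show α₀.re + 2 - 2 = α₀.re + 1 - 2 + 1 by ring, Real.rpow_add_one hp.ne']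
    have e2 : p ^ (α₀.re - 2) = p ^ (α₀.re - 1 - 2) * p := by
      rw [show α₀.re - 2 = α₀.re - 1 - 2 + 1 by ring, Real.rpow_add_one hp.ne']
    rw [e1, e2]
    calc P * (p ^ (α.re - 2) * q ^ (β.re - 2)) * ‖Complex.log ((hermTwo c + hermTwo e).det)‖
        ≤ P * ((p ^ (α₀.re + 1 - 2) + p ^ (α₀.re - 1 - 2)) * q ^ (β.re - 2)) * (|Real.log δ| + p) := h1
      _ = |Real.log δ| * (P * (p ^ (α₀.re + 1 - 2) * q ^ (β.re - 2)) + P * (p ^ (α₀.re - 1 - 2) * q ^ (β.re - 2))) +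
            (P * (p ^ (α₀.re + 1 - 2) * p * q ^ (β.re - 2)) + P * (p ^ (α₀.re - 1 - 2) * p * q ^ (β.re - 2))) := by ring
  · -- integrability of the bound
    exact ((hI1.add hI2).const_mul _).add (hI3.add hI4)
  · -- the pointwise derivative, for `x` in the domain
    refine (ae_restrict_iff' (measurableSet_etaTwoSet hh.1)).mpr (Filter.Eventually.of_forall fun c hc α _ => ?_)
    exact hasDerivAt_etaTwoIntegrand_alpha g (hermTwo e) β (det_pos_of_mem_etaTwoSet hc).1.ne' α

/-- **`η(g, h; ·, β)` IS ENTIRE IN `α`** for `g, h > 0`, `re β > 1` [Shimura1982, §3, `h > 0`]. -/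
theorem differentiable_etaTwo_alpha {g h : Matrix (Fin 2) (Fin 2) ℂ} (hg : g.PosDef) (hh : h.PosDef) {β : ℂ} (hβ : 1 < β.re) :
    Differentiable ℂ (fun α : ℂ => etaTwo g h α β) :=
  fun α₀ => (hasDerivAt_etaTwo_alpha hg hh hβ α₀).differentiableAt

/-! ## The entire continuation of `ξ(g, h; ·, β)` -/

/-- `Γ₂(α)⁻¹ = π⁻¹ Γ(α)⁻¹ Γ(α − 1)⁻¹` is entire. -/
theorem differentiable_hermTwoGamma_inv : Differentiable ℂ (fun α : ℂ => (hermTwoGamma α)⁻¹) := by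
  have h : (fun α : ℂ => (hermTwoGamma α)⁻¹) =
      fun α => (Real.pi : ℂ)⁻¹ * ((Complex.Gamma α)⁻¹ * (Complex.Gamma (α - 1))⁻¹) := by
    funext α
    rw [hermTwoGamma_def, mul_inv, mul_inv, mul_assoc]
  rw [h]
  exact (Complex.differentiable_one_div_Gamma.mul
    (Complex.differentiable_one_div_Gamma.comp (differentiable_id.sub_const 1))).const_mul _

/-- **THE RIGHT-HAND SIDE OF THE ξ–η IDENTITY IS ENTIRE IN `α`**: for `g, h > 0` and `re β > 1`,
`α ↦ 4π⁴ · e^{iπ(β−α)} · Γ₂(α)⁻¹ · Γ₂(β)⁻¹ · η(2g, πh; α, β)` is complex-differentiable on all of `ℂ`. -/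
theorem differentiable_xiEtaRhs {g h : Matrix (Fin 2) (Fin 2) ℂ} (hg : g.PosDef) (hh : h.PosDef) {β : ℂ} (hβ : 1 < β.re) :
    Differentiable ℂ (fun α : ℂ => ((4 * Real.pi ^ 4 : ℝ) : ℂ) * cexp ((Real.pi * I) * (β - α)) * (hermTwoGamma α)⁻¹ *
      (hermTwoGamma β)⁻¹ * etaTwo ((2 : ℂ) • g) ((Real.pi : ℂ) • h) α β) := by
  have h2g : ((2 : ℂ) • g).PosDef := by
    rw [two_smul]
    exact hg.add hg
  obtain ⟨e, rfl⟩ : ∃ e : ℝ × ℂ × ℝ, hermTwo e = h := ⟨_, hermTwo_eq_of_isHermitian hh.1⟩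
  have hπh : ((Real.pi : ℂ) • hermTwo e).PosDef := by
    rw [← hermTwo_smul]
    exact posDef_hermTwo_smul Real.pi_pos hh
  have hη := differentiable_etaTwo_alpha h2g hπh hβ
  have hexp : Differentiable ℂ (fun α : ℂ => cexp ((Real.pi * I) * (β - α))) :=
    (((differentiable_const β).sub differentiable_id).const_mul _).cexp
  exact ((((differentiable_const _).mul hexp).mul differentiable_hermTwoGamma_inv).mul (differentiable_const _)).mul hη

/-- **SHIMURA'S CONTINUATION OF `ξ(g, h; ·, β)` (`g, h > 0`, `re β > 1`; [Shimura1982, Thm 3.1, the `h > 0` half, in the variable `α`])**: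
there is an ENTIRE function `A` with `ξ(g, h; α, β) = A(α)` on the half-plane `re α > 3` of absolute convergence — namely the right-hand
side of the ξ–η identity. -/
theorem xiTwo_eq_entire {g h : Matrix (Fin 2) (Fin 2) ℂ} (hg : g.PosDef) (hh : h.PosDef) {β : ℂ} (hβ : 1 < β.re) :
    ∃ A : ℂ → ℂ, Differentiable ℂ A ∧ ∀ α : ℂ, 3 < α.re → xiTwo g h α β = A α :=
  ⟨_, differentiable_xiEtaRhs hg hh hβ, fun _ hα => xiTwo_eq_etaTwo hg hh hα hβ⟩

end Summit.HodgeConjecture.HodgeConjecture.Cruxes.HLiu418.K2LiuHermTwoEtaHolomorphy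

end
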